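import Summits.BirchSwinnertonDyer.Rank1Residual.X12.O11.RouteUJacobiPsi
import Summits.BirchSwinnertonDyer.Rank1Residual.X12.O11.RouteUPrimeTwin
import HarnessLib

/-!
# ROUTE U, odd (possibly COMPOSITE) members `49a1^{(−m)}`: the DESCENT side (`7 ∤ #Ш(W)`, Buhler–Gross
# 1985 Ch. II BY NAME) and the TWIN side (`7 ∤ #Ш(W^{(−r)})`, Rubin 1983 Thm C BY NAME), for a PRIMITIVE
# Jacobi-valued character `χ` mod `m`

bsd-cm cell (run/shared/lean/pub/bsd-cm/), ROUTE U (Theorem U: BSD(49a1^{(D)}, 7)), seat `bsd-cm-ram`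
(g5). `RouteUPrimeTwin` did this for a prime `q`; here `m` is any squarefree `m ≡ 3 (mod 4)` coprime to
`7`, with `χ` mod `m` ASSUMED primitive with values `J(· | m)` (for `m = q₁q₂`:
`RouteUPrimeTwin.jacobiCharMul_*`). Parameters: `r ≡ 3 (mod 4)` prime, coprime to `7m` (Heegner field
`ℚ(√−r)`, twin `49a1^{(mr)}`). Inputs: the two Bernoulli-unit certificate hypotheses (`hcert₁`:
`‖B_{1,ω⁴χ_{−m}}‖₇ = 1` at level `7m`; `hcert₂`: `‖B_{1,ωχ_{−m}χ_{−r}}‖₇ = 1` at level `7mr`).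

* §1 `norm_bernoulliOnePrim_mulTeichmuller_pow_four_J` + **`not_seven_dvd_shaOrder_of_buhlerGross_J`** —
  `7 ∤ #Ш(W)` for `W` any model of `49a1^{(−m)}` of rank `≥ 1`
  (`BuhlerGross1985.firstDescent_seven_oddTwist_of_bernoulli` (iii) with `M = ℚ(√−m)`, `χ_M = J(·|m)↑`);
* §2 the character `χ↑·χ_r↑` mod `mr` (values `J(·|mr)`, primitive, even) and
  **`not_seven_dvd_shaOrder_twin_J`** — `7 ∤ #Ш(Wd)` for every model `Wd` of `W^{(−r)} ≅ 49a1^{(mr)}`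
  (`Rubin1983.thmC_seven_quadraticField` over `M = ℚ(√(mr))`); `twin_value_J` — the twin's VALUE binder
  from Burungale–Flach 2024 BY NAME (as `twin_value_prime`, positivity of `m`, `r` only).

THEOREMS ONLY; no definitions, no new named facts; nothing booked.
References: [BuhlerGross1985] Ch. II §§7–9; [Rubin1983] Thm C; [KrizLi2019] §1.5, Thm 1.20;
[Cox2013] Lemma 1.14; [Washington1997] §5.1; [BurungaleFlach2024] Thm 1.1.
-/

noncomputable section

open scoped Classical
open NumberField WeierstrassCurve DirichletCharacter
open Literature.NumberTheory.EllipticCurves Literature.NumberTheory.EllipticCurves.Rank1Residual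
open Literature.NumberTheory.EllipticCurves.KrizLi2019 Literature.NumberTheory.LFunctions
open Literature.NumberTheory.EllipticCurves.Rubin1983 (mulTeichmuller thmC_seven_quadraticField)
open Literature.NumberTheory.QuadraticFields
open Literature.NumberTheory.EllipticCurves.BuhlerGross1985 (firstDescent_seven_oddTwist_of_bernoulli)

namespace Summit.BirchSwinnertonDyer.Rank1Residual.X12.O11.RouteU

/-! ## §0 `−m` and `m·r` are fundamental discriminants -/

/-- For `m ≡ 3 (mod 4)` squarefree: `−m` is a fundamental discriminant (`−m ≡ 1 (mod 4)`).
[cite: Cox2013, §1.C Lemma 1.14] -/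
theorem isFundamental_neg_of_squarefree {m : ℕ} (hm4 : m % 4 = 3) (hsq : Squarefree m) :
    ((-(m : ℤ)) % 4 = 1 ∧ Squarefree (-(m : ℤ)) ∧ (-(m : ℤ)) ≠ 1) ∨
      (4 ∣ (-(m : ℤ)) ∧ ((-(m : ℤ)) / 4 % 4 = 2 ∨ (-(m : ℤ)) / 4 % 4 = 3) ∧
        Squarefree ((-(m : ℤ)) / 4)) := by
  refine Or.inl ⟨?_, ?_, ?_⟩
  · have : ((m : ℤ) % 4) = 3 := by exact_mod_cast hm4
    omega
  · rw [← Int.squarefree_natAbs]; simpa using hsq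
  · omega

/-- For `m ≡ 3 (mod 4)` squarefree and a prime `r ≡ 3 (mod 4)` not dividing `m`: `m·r` is a fundamental
discriminant (`mr ≡ 1 (mod 4)`, squarefree). [cite: Cox2013, §1.C Lemma 1.14] -/
theorem isFundamental_mul_of_squarefree {m r : ℕ} [hr : Fact r.Prime] (hm4 : m % 4 = 3) (hr4 : r % 4 = 3)
    (hsq : Squarefree m) (hrm : r.Coprime m) :
    (((m * r : ℕ) : ℤ) % 4 = 1 ∧ Squarefree ((m * r : ℕ) : ℤ) ∧ ((m * r : ℕ) : ℤ) ≠ 1) ∨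
      (4 ∣ ((m * r : ℕ) : ℤ) ∧ (((m * r : ℕ) : ℤ) / 4 % 4 = 2 ∨ ((m * r : ℕ) : ℤ) / 4 % 4 = 3) ∧
        Squarefree (((m * r : ℕ) : ℤ) / 4)) := by
  refine Or.inl ⟨?_, ?_, ?_⟩
  · have : (m * r) % 4 = 1 := by rw [Nat.mul_mod, hm4, hr4]
    exact_mod_cast this
  · rw [Int.squarefree_natCast, Nat.squarefree_mul hrm.symm]
    exact ⟨hsq, hr.out.squarefree⟩
  · have : 3 ≤ m := by have := Nat.mod_le m 4; omega
    have : 2 ≤ r := hr.out.two_le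
    have : 6 ≤ m * r := by nlinarith
    exact_mod_cast (show m * r ≠ 1 by omega)

/-! ## §1 `7 ∤ #Ш(W)` from Buhler–Gross 1985 Ch. II BY NAME -/

section ThetaOne

variable {m : ℕ} [hm : NeZero m] (ω : DirichletCharacter ℚ_[7] 7) (χ : DirichletCharacter ℚ_[7] m)

/-- **`‖B_{1,χ_Mω⁴}‖₇ = 1` in Buhler–Gross's shape from the `θ₁`-certificate** (Jacobi-valued primitive
`χ` mod `m` transported to any level `n` with `m ∣ n`): `mulTeichmuller (χ↑) (ω⁴)` lifts
`θ₁ = χ↑·(ω⁴)↑ = ψ_m⁻¹` (primitive, `psiJ_inv_isPrimitive`). [cite: BuhlerGross1985, Ch. II Prop. (8.3)(1) (p. 17)]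
[cite: KrizLi2019, §1.5 display (1) (p. 7)] -/
theorem norm_bernoulliOnePrim_mulTeichmuller_pow_four_J (hω : IsTeichmullerCharacter ω)
    (hm7 : m.Coprime 7) (hχ : ∀ a : ℕ, χ (a : ZMod m) = (jacobiSym (a : ℤ) m : ℚ_[7]))
    (hχp : χ.IsPrimitive)
    (hcert₁ : ∀ θ : DirichletCharacter ℚ_[7] (7 * m),
        (∀ j : ZMod (7 * m), θ j = (jacobiSym (j.val : ℤ) m : ℚ_[7]) * ω (j.val : ZMod 7) ^ 4) →
        ‖generalizedBernoulli 1 θ‖ = 1)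
    {n : ℕ} [NeZero n] (h : m ∣ n) :
    ‖bernoulliOnePrim (mulTeichmuller (changeLevel h χ) (ω ^ 4))‖ = 1 := by
  have hqq : 7 * m ∣ n * 7 := by rw [mul_comm 7 m]; exact mul_dvd_mul_right h 7
  have e : mulTeichmuller (changeLevel h χ) (ω ^ 4) =
      changeLevel hqq (changeLevel (dvd_mul_left m 7) χ * changeLevel (dvd_mul_right 7 m) (ω ^ 4)) := by
    rw [mulTeichmuller]
    simp only [map_mul, ← changeLevel_trans]
  rw [e, bernoulliOnePrim_changeLevel_eq _
    (by rw [thetaOneJ_eq_psiJ_inv ω χ hχ]; exact psiJ_inv_isPrimitive ω χ hm7 hω hχp) hqq]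
  exact hcert₁ _ (thetaOneJ_apply ω χ hχ)

/-- **`7 ∤ #Ш(W)` from Buhler–Gross 1985 Ch. II BY NAME, odd squarefree `m`** (the `√−7`-descent on
the odd twists of `A(7) = 49a1`, named fact `BuhlerGross1985.firstDescent_seven_oddTwist_of_bernoulli`,
clause (iii)): for `W` any model of `49a1^{(−m)}` (`m ≡ 3 (mod 4)` squarefree, coprime to `7`) of
Mordell–Weil rank `≥ 1` with `Ш(W)` finite, given a primitive Jacobi-valued `χ` mod `m` and the
`θ₁`-certificate. `M = ℚ(√−m)` is produced inside; its Kronecker character is `J(·|m)↑`.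
[cite: BuhlerGross1985, Ch. II Prop. (7.2)(2), (8.3)(1) and Cor. (9.1) proof (pp. 16–18)] -/
theorem not_seven_dvd_shaOrder_of_buhlerGross_J
    (hBG : BuhlerGross1985.firstDescent_seven_oddTwist_of_bernoulli) (hm4 : m % 4 = 3)
    (hsq : Squarefree m) (hm7 : m.Coprime 7)
    (hχ : ∀ a : ℕ, χ (a : ZMod m) = (jacobiSym (a : ℤ) m : ℚ_[7])) (hχp : χ.IsPrimitive)
    (hcert₁ : ∀ (ω : DirichletCharacter ℚ_[7] 7), IsTeichmullerCharacter ω →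
      ∀ θ : DirichletCharacter ℚ_[7] (7 * m),
        (∀ j : ZMod (7 * m), θ j = (jacobiSym (j.val : ℤ) m : ℚ_[7]) * ω (j.val : ZMod 7) ^ 4) →
        ‖generalizedBernoulli 1 θ‖ = 1)
    (W : WeierstrassCurve ℚ) [W.IsElliptic]
    (hW : ∃ C : VariableChange ℚ, C • W = cm7.quadraticTwist ((-(m : ℤ) : ℤ) : ℚ))
    (hrk : 1 ≤ W.mordellWeilRank) [Finite W.sha] : ¬ 7 ∣ W.shaOrder := by
  haveI : Fact (Nat.Prime 7) := ⟨by norm_num⟩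
  have hm3 : 3 ≤ m := by have := Nat.mod_le m 4; omega
  obtain ⟨ω, hω⟩ := exists_isTeichmullerCharacter (p := 7)
  obtain ⟨M, _, _, hM2, hdM⟩ := Quadratic.exists_numberField_discr_eq (isFundamental_neg_of_squarefree hm4 hsq)
  have hnat : (NumberField.discr M).natAbs = m := by rw [hdM]; simp
  haveI : NeZero (NumberField.discr M).natAbs := ⟨by rw [hnat]; exact hm.out⟩
  have hMim : IsImaginaryQuadratic M :=
    ⟨hM2, Quadratic.isTotallyComplex_of_discr_neg hM2 (by rw [hdM]; omega)⟩
  have h7M : ¬ ((7 : ℤ) ∣ NumberField.discr M) := by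
    rw [hdM, dvd_neg]
    intro h
    have h' : 7 ∣ m := by exact_mod_cast h
    have := Nat.Coprime.eq_one_of_dvd (hm7.symm) h'
    norm_num at this
  have hdiv : m ∣ (NumberField.discr M).natAbs := by rw [hnat]
  have hεM : IsKroneckerCharacterOf M (changeLevel hdiv χ) :=
    isKroneckerCharacterOf_changeLevel_jacobi hM2 (Or.inr ⟨hdM, hm4⟩) χ hχp hχ hdiv
  have hB : ¬ (‖bernoulliOnePrim (mulTeichmuller (changeLevel hdiv χ) (ω ^ 4))‖ ≤ (7 : ℝ)⁻¹) := by
    rw [norm_bernoulliOnePrim_mulTeichmuller_pow_four_J ω χ hω hm7 hχ hχp (hcert₁ ω hω) hdiv]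
    norm_num
  have hW' : ∃ C : VariableChange ℚ, C • W = cm7.quadraticTwist (NumberField.discr M : ℚ) := by
    rw [hdM]; exact hW
  obtain ⟨-, -, hsha⟩ := hBG ω hω M hMim h7M (changeLevel hdiv χ) hεM hB W hW'
  intro h7
  obtain ⟨x, hx⟩ := exists_prime_addOrderOf_dvd_card' (G := W.sha) 7 h7
  have hx0 : x ≠ 0 := by
    intro h0; rw [h0, addOrderOf_zero] at hx; norm_num at hx
  have h7x' : (7 : ℕ) • x = 0 := by rw [← hx]; exact addOrderOf_nsmul_eq_zero x
  have h7x : (7 : ℕ) • (x : W.galH1) = 0 := by exact_mod_cast congrArg Subtype.val h7x'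
  exact hx0 (Subtype.ext (hsha hrk x x.2 h7x))

end ThetaOne

/-! ## §2 The character `χ_m↑·χ_r↑` mod `m·r` and the twin `49a1^{(mr)}` (Rubin Thm C BY NAME) -/

section Twin

variable {m r : ℕ} [hm : NeZero m] [hr : Fact r.Prime]
  (χ : DirichletCharacter ℚ_[7] m) (κ : DirichletCharacter ℚ_[7] r)

/-- `m·r ≠ 0`. [folklore] -/
@[instance] theorem neZero_level_mul_prime : NeZero (m * r) := ⟨Nat.mul_ne_zero hm.out hr.out.ne_zero⟩

/-- **Values of `χ_m↑ · χ_r↑` mod `mr`: `J(a | mr)`** for Jacobi-valued `χ` mod `m`, Legendre-valued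
`κ` mod `r`. [cite: Cox2013, §1.C Lemma 1.14] -/
theorem jacobiCharMulJ_apply
    (hχ : ∀ a : ℕ, χ (a : ZMod m) = (jacobiSym (a : ℤ) m : ℚ_[7]))
    (hκ : ∀ a : ℕ, κ (a : ZMod r) = (legendreSym r (a : ℤ) : ℚ_[7])) (a : ℕ) :
    (changeLevel (dvd_mul_right m r) χ * changeLevel (dvd_mul_left r m) κ) (a : ZMod (m * r))
      = (jacobiSym a (m * r) : ℚ_[7]) := by
  have hJ : jacobiSym a (m * r) = jacobiSym a m * legendreSym r a := by
    rw [jacobiSym.mul_right, ← jacobiSym.legendreSym.to_jacobiSym r]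
  have ha : ((a : ℤ) : ZMod (m * r)) = (a : ZMod (m * r)) := Int.cast_natCast a
  by_cases hu : IsCoprime (a : ℤ) ((m * r : ℕ) : ℤ)
  · rw [← ha, MulChar.mul_apply, changeLevel_eq_cast_of_dvd' _ _ hu,
      changeLevel_eq_cast_of_dvd' _ _ hu, Int.cast_natCast, Int.cast_natCast, hχ, hκ, hJ,
      Int.cast_mul]
  · have hnu : ¬ IsUnit (a : ZMod (m * r)) := by
      rw [← ha, ZMod.coe_int_isUnit_iff_isCoprime]; exact fun h => hu (isCoprime_comm.mp h)
    rw [MulChar.map_nonunit _ hnu]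
    have hg : (a : ℤ).gcd (m * r) ≠ 1 := fun h1 => hu (Int.isCoprime_iff_gcd_eq_one.mpr h1)
    rw [jacobiSym.eq_zero_iff.mpr ⟨NeZero.ne _, hg⟩, Int.cast_zero]

/-- `χ_m↑ · χ_r↑` mod `mr` is **primitive** (`χ` primitive mod `m`, `r` an odd prime not dividing `m`).
[folklore] -/
theorem jacobiCharMulJ_isPrimitive (hrm : r.Coprime m) (hr2 : r ≠ 2) (hχp : χ.IsPrimitive)
    (hκ : ∀ a : ℕ, κ (a : ZMod r) = (legendreSym r (a : ℤ) : ℚ_[7])) :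
    (changeLevel (dvd_mul_right m r) χ * changeLevel (dvd_mul_left r m) κ).IsPrimitive := by
  have hcq : χ.conductor = m := hχp
  have hcr := conductor_eq_of_prime_of_ne_one κ (legendreChar_ne_one hr2 κ hκ)
  change DirichletCharacter.conductor _ = m * r
  rw [conductor_changeLevel_mul_changeLevel _ _ χ κ (by rw [hcq, hcr]; exact hrm.symm), hcq, hcr]

/-- `χ_m↑ · χ_r↑` mod `mr` is **even** when `mr ≡ 1 (mod 4)` (`J(−1 | mr) = χ₄(mr) = 1`). [folklore] -/
theorem jacobiCharMulJ_even (hmr4 : (m * r) % 4 = 1)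
    (hχ : ∀ a : ℕ, χ (a : ZMod m) = (jacobiSym (a : ℤ) m : ℚ_[7]))
    (hκ : ∀ a : ℕ, κ (a : ZMod r) = (legendreSym r (a : ℤ) : ℚ_[7])) :
    (changeLevel (dvd_mul_right m r) χ * changeLevel (dvd_mul_left r m) κ).Even := by
  have h1 : 1 ≤ m * r := Nat.one_le_iff_ne_zero.mpr (NeZero.ne _)
  have hneg : (-1 : ZMod (m * r)) = ((m * r - 1 : ℕ) : ZMod (m * r)) := by
    rw [Nat.cast_sub h1, Nat.cast_one, ZMod.natCast_self, zero_sub]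
  change _ = (1 : ℚ_[7])
  rw [hneg, jacobiCharMulJ_apply χ κ hχ hκ]
  have hodd : Odd (m * r) := Nat.odd_iff.mpr (by omega)
  have e : ((m * r - 1 : ℕ) : ℤ) = -1 + (m * r : ℕ) * 1 := by push_cast [Nat.cast_sub h1]; ring
  rw [e, jacobiSym.mod_left, Int.add_mul_emod_self_left, ← jacobiSym.mod_left, jacobiSym.at_neg_one hodd,
    ZMod.χ₄_nat_one_mod_four hmr4]
  simp

/-- **`‖B_{1,χ_{mr}ω}‖₇ = 1` from a `θ₂`-certificate** (`χ` primitive Jacobi-valued mod `m`, `κ'`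
primitive mod `r`): `mulTeichmuller (χ↑·κ'↑) ω` IS `θ₂` of `RouteUJacobiPsi` lifted along
`7·m·r ∣ m·r·7`. [cite: Rubin1983, §0 Thm. C (p. 341)] [cite: KrizLi2019, §1.5 display (1) (p. 7)] -/
theorem norm_bernoulliOnePrim_mulTeichmuller_J (ω : DirichletCharacter ℚ_[7] 7)
    (hω : IsTeichmullerCharacter ω) (hm7 : m.Coprime 7) (hr7 : r.Coprime 7) (hrm : r.Coprime m)
    (κ' : DirichletCharacter ℚ_[7] r) (hκ'p : κ'.IsPrimitive) (hχp : χ.IsPrimitive)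
    (hcert₂ : ‖generalizedBernoulli 1
      (changeLevel ((dvd_mul_left m 7).trans (dvd_mul_right (7 * m) r)) χ *
        changeLevel (dvd_mul_left r (7 * m)) κ' *
        changeLevel ((dvd_mul_right 7 m).trans (dvd_mul_right (7 * m) r)) ω :
        DirichletCharacter ℚ_[7] (7 * m * r))‖ = 1) :
    ‖bernoulliOnePrim (mulTeichmuller
      (changeLevel (dvd_mul_right m r) χ * changeLevel (dvd_mul_left r m) κ') ω)‖ = 1 := by
  have hdiv : 7 * m * r ∣ m * r * 7 := ⟨1, by ring⟩
  have hΘ : mulTeichmuller (changeLevel (dvd_mul_right m r) χ * changeLevel (dvd_mul_left r m) κ') ω =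
      changeLevel hdiv
        (changeLevel ((dvd_mul_left m 7).trans (dvd_mul_right (7 * m) r)) χ *
          changeLevel (dvd_mul_left r (7 * m)) κ' *
          changeLevel ((dvd_mul_right 7 m).trans (dvd_mul_right (7 * m) r)) ω) := by
    rw [mulTeichmuller]
    simp only [map_mul, ← changeLevel_trans]
  rw [hΘ, bernoulliOnePrim_changeLevel_eq _ (thetaTwoJ_isPrimitive ω χ κ' hm7 hr7 hrm hω hχp hκ'p) hdiv]
  exact hcert₂

/-- **The twin side BY NAME, odd squarefree `m`**: for every model `W` of `49a1^{(−m)}` and every elliptic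
model `Wd` of `W^{(−r)}` (`≅ 49a1^{(mr)}`) with `Ш(Wd)` finite: `7 ∤ #Ш(Wd)` — Rubin 1983 Thm C at `p = 7`
over `M = ℚ(√(mr))` (named fact `thmC_seven_quadraticField`), its two Bernoulli conditions discharged by
`‖B_{1,ω}‖₇ = 1` (kernel) and the `θ₂`-certificate hypothesis.
[cite: Rubin1983, §0 Thm. C (p. 341)] [cite: BuhlerGross1985, Prop. (8.4)(1) and Cor. (9.1) (p. 18)] -/
theorem not_seven_dvd_shaOrder_twin_J (h : thmC_seven_quadraticField)
    (hm4 : m % 4 = 3) (hsq : Squarefree m) (hm7 : m.Coprime 7) (hr4 : r % 4 = 3) (hr7 : r ≠ 7)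
    (hrm : r.Coprime m)
    (hχ : ∀ a : ℕ, χ (a : ZMod m) = (jacobiSym (a : ℤ) m : ℚ_[7])) (hχp : χ.IsPrimitive)
    (hcert₂ : ∀ (ω : DirichletCharacter ℚ_[7] 7), IsTeichmullerCharacter ω →
      ∀ θ : DirichletCharacter ℚ_[7] (7 * m * r),
        (∀ j : ZMod (7 * m * r), θ j =
          ((jacobiSym (j.val : ℤ) m * jacobiSym (j.val : ℤ) r : ℤ) : ℚ_[7]) * ω (j.val : ZMod 7) ^ 1) →
        ‖generalizedBernoulli 1 θ‖ = 1)
    (W : WeierstrassCurve ℚ)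
    (hW : ∃ C : VariableChange ℚ, C • W = cm7.quadraticTwist ((-(m : ℤ) : ℤ) : ℚ))
    (Wd : WeierstrassCurve ℚ) [Wd.IsElliptic] (Cd : VariableChange ℚ)
    (hWd : Cd • W.quadraticTwist ((-(r : ℤ) : ℤ) : ℚ) = Wd) [Finite Wd.sha] :
    ¬ 7 ∣ Wd.shaOrder := by
  have hr2 : r ≠ 2 := by rintro rfl; norm_num at hr4
  have hr7' : r.Coprime 7 := (Nat.coprime_primes hr.out (by norm_num)).mpr hr7
  obtain ⟨ω, hω⟩ := exists_isTeichmullerCharacter (p := 7)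
  obtain ⟨M, _, _, hM2, hdM⟩ := Quadratic.exists_numberField_discr_eq
    (isFundamental_mul_of_squarefree hm4 hr4 hsq hrm)
  have hnat : (NumberField.discr M).natAbs = m * r := by rw [hdM]; rfl
  haveI : NeZero (NumberField.discr M).natAbs := ⟨by rw [hnat]; exact NeZero.ne _⟩
  obtain ⟨κ', hκ'⟩ := exists_legendreCharacter r
  have hκ'J : ∀ a : ℕ, κ' (a : ZMod r) = (jacobiSym (a : ℤ) r : ℚ_[7]) := fun a => by
    rw [hκ', jacobiSym.legendreSym.to_jacobiSym]
  have hκ'p : κ'.IsPrimitive := conductor_eq_of_prime_of_ne_one κ' (legendreChar_ne_one hr2 κ' hκ')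
  -- the Kronecker character of `M = ℚ(√(mr))`
  set κM := changeLevel (dvd_mul_right m r) χ * changeLevel (dvd_mul_left r m) κ' with hκM
  have hdiv : m * r ∣ (NumberField.discr M).natAbs := by rw [hnat]
  have hmr4 : (m * r) % 4 = 1 := by rw [Nat.mul_mod, hm4, hr4]
  have hK : IsKroneckerCharacterOf M (changeLevel hdiv κM) :=
    isKroneckerCharacterOf_changeLevel_jacobi hM2 (Or.inl ⟨hdM, hmr4⟩) κM
      (jacobiCharMulJ_isPrimitive χ κ' hrm hr2 hχp hκ') (jacobiCharMulJ_apply χ κ' hχ hκ') hdiv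
  have heven : (changeLevel hdiv κM).Even := by
    change changeLevel hdiv κM (-1) = 1
    have hc : IsCoprime (-1 : ℤ) (((NumberField.discr M).natAbs : ℕ) : ℤ) := isCoprime_one_left.neg_left
    have hv := changeLevel_eq_cast_of_dvd' κM hdiv hc
    push_cast at hv
    rw [hv]
    exact jacobiCharMulJ_even χ κ' hmr4 hχ hκ'
  have h7 : ¬ ((7 : ℤ) ∣ NumberField.discr M) := by
    rw [hdM]
    intro hdvd
    have : (7 : ℕ) ∣ m * r := by exact_mod_cast hdvd
    rcases (Nat.Prime.dvd_mul (by norm_num)).mp this with h | h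
    · have := Nat.Coprime.eq_one_of_dvd hm7.symm h; norm_num at this
    · exact hr7 (((Nat.prime_dvd_prime_iff_eq (by norm_num) hr.out).mp h).symm)
  have hB₁ := not_norm_mul_le_inv_of_norm_eq_one (p := 7)
    (norm_bernoulliOnePrim_teichmuller_seven ω hω) (norm_bernoulliOnePrim_teichmuller_seven ω hω)
  have hu2 : ‖bernoulliOnePrim (mulTeichmuller (changeLevel hdiv κM) ω)‖ = 1 := by
    have e : mulTeichmuller (changeLevel hdiv κM) ω =
        changeLevel (mul_dvd_mul_right hdiv 7) (mulTeichmuller κM ω) := by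
      rw [mulTeichmuller, mulTeichmuller]
      simp only [map_mul, ← changeLevel_trans]
    rw [e, bernoulliOnePrim_changeLevel]
    exact norm_bernoulliOnePrim_mulTeichmuller_J χ ω hω hm7 hr7' hrm κ' hκ'p hχp
      (hcert₂ ω hω _ (thetaTwoJ_apply ω χ κ' hχ hκ'J))
  have hB₂ := not_norm_mul_le_inv_of_norm_eq_one (p := 7) hu2 hu2
  have hWd' : ∃ C' : VariableChange ℚ, C' • cm7.quadraticTwist (NumberField.discr M : ℚ) = Wd := by
    have e : ((NumberField.discr M : ℤ) : ℚ) = ((-(m : ℤ) : ℤ) : ℚ) * ((-(r : ℤ) : ℤ) : ℚ) := by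
      rw [hdM]; push_cast; ring
    rw [e]
    exact exists_variableChange_cm7_twist_twist W hW Wd Cd hWd
  exact_mod_cast Rubin1983.not_dvd_shaOrder_twist_of_bernoulli h ω hω M hM2 h7 (changeLevel hdiv κM) hK
    (by exact_mod_cast hB₁) heven (by exact_mod_cast hB₂) Wd hWd'

omit hm in
/-- **The twin's VALUE binder `htw` from Burungale–Flach 2024 (BY NAME), odd member** (`m, r > 0`).
[cite: BurungaleFlach2024, Thm 1.1 and Cor. 2] [cite: Miller2011LMS, §1 and Def. 1.1 (arXiv:1010.2431 p. 3)] -/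
theorem twin_value_J (hBF : bsdTriple_of_hasCM_of_L_one_ne_zero)
    (hGZK : rank_eq_analyticRank_of_analyticRank_le_one) (hmod : hasEntireLFunction_rat) (hm0 : 0 < m)
    (W : WeierstrassCurve ℚ) [W.IsElliptic]
    (hW : ∃ C : VariableChange ℚ, C • W = cm7.quadraticTwist ((-(m : ℤ) : ℤ) : ℚ))
    (Wd : WeierstrassCurve ℚ) [Wd.IsElliptic] [Wd.IsGloballyMinimal] (Cd : VariableChange ℚ)
    (hWd : Cd • W.quadraticTwist ((-(r : ℤ) : ℤ) : ℚ) = Wd)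
    (hLt : (W.quadraticTwist ((-(r : ℤ) : ℤ) : ℚ)).entireLFunction 1 ≠ 0) :
    ∃ x : ℚ, Wd.entireLFunction 1 / (Wd.realPeriodRat : ℂ) = (x : ℂ) ∧
      padicValRat 7 x = (padicValNat 7 Wd.shaOrder : ℤ) + padicValNat 7 Wd.tamagawaProduct -
        2 * padicValNat 7 Wd.torsionOrder := by
  haveI : Fact (Nat.Prime 7) := ⟨by norm_num⟩
  have hCM : Wd.HasCM := hasCM_twin_prime hm0 hr.out.pos W hW Wd Cd hWd
  have hL : Wd.entireLFunction 1 ≠ 0 := by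
    have h' : W.quadraticTwist ((-(r : ℤ) : ℤ) : ℚ) = Cd⁻¹ • Wd := by rw [← hWd, inv_smul_smul]
    rw [h', entireLFunction_smul] at hLt
    exact hLt
  have hr0 : Wd.analyticRank = 0 := (analyticRank_eq_zero_iff_holds (W := Wd) (hmod Wd)).mpr hL
  exact X11b.Three.exists_LOne_div_realPeriodRat_of_bsdp_rankZero hGZK hmod Wd 7 hr0
    (forall_bsdp_of_bsdTriple' Wd (hBF Wd hCM hL) 7 (by norm_num))

end Twin

end Summit.BirchSwinnertonDyer.Rank1Residual.X12.O11.RouteU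

end
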